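import Literature.NumberTheory.Rogawski1990.ArchCompatibleFamilies          -- ★ `ArchCompatibleFamiliesG ∕ H` (frame of the organ text; not read by the proof)
import Literature.NumberTheory.Rogawski1990.ArchExplicitTransferFactor      -- ★ `archExplicitTransferFactor` = print's `Δ″_∞` (the organ text's factor; the core lemma is factor-generic)
import Literature.NumberTheory.Automorphic.QuadraticHeckeCharacterCM        -- ★ `quadraticHeckeCharCM` (the μ-guard binder of the organ text)
import Literature.NumberTheory.Rogawski1990.ArchEndoscopicEigenvalueCompact -- ★ p848061 (LH3-p03): (EIG→CPT) `exists_isCompact_isArchStablyConjH_of_isConj_endoEmbArch` (ED. 2)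
import HarnessLib

/-!
# The `Δ`-side of the archimedean endoscopic transfer identity is supported on the stable classes meeting a compact set
# (organ O2 `stub_N9transferSideBounded` of the `stub_N9` pay-down line `F0_P3c_StubN9Paydown`; Shelstad 2012, proof of Cor. 2.2)

Topic `NumberTheory/Rogawski1990`; namespace `Literature.NumberTheory.Rogawski1990`.  THEOREMS ONLY (no definition, no instance, no notation, no named
fact, no `sorry`).  Cell `pub/hodgecm-mathlib`, F0∕P3c line LH3 (closer stub `stub_N9` of `Cruxes/H413/Lines/F0_U3LettersRung1.lean`, crux H413 =
`stmt-HodgeConjecture-24833`); seat LH3-p02 (g0); lane `--supports stmt-HodgeConjecture-24833`.  HONEST LABEL: HC_CM is proved only modulo the 7 printed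
citations (2 remaining: hLiu418 = stmt-HodgeConjecture-24832, h413 = stmt-HodgeConjecture-24833) until rung 0 closes; this file is measure-free bookkeeping
and pays no printed statement by itself.

THE MATHEMATICS.  [Shelstad2012, proof of Cor. 2.2 p. 1926]: «because the stable orbital integrals of `f₁⁰` vanish off the conjugacy classes meeting a set in
`H₁(ℝ)` that is bounded modulo `Z₁(ℝ)`, Bouaziz's characterization … shows that there exists `f₁ ∈ C_c^∞(H₁(ℝ))` …».  The vanishing is read off the `G′`-side
of the transfer identity `Φ^st(γ_H, f₁⁰) = Σ_{[γ′]} Δ(γ_H, γ′) Φ([γ′], a′)` [Rogawski1990, §4.3 (4.3.1) p. 43; §14.3 p. 234]: a non-zero term at the class `[γ′]`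
of `G′_∞ = U(H′)(L⁺ ⊗ ℝ)` forces (i) `ι_∞(γ_H) ↔ γ′` — the factor is supported on norm pairs (★ `TransferFactorData.eq_zero_of_not_rel`), i.e. `ι_∞(γ_H)` and
`γ′` are conjugate in `GL₃(L ⊗ ℝ)` (★ `Corresponds`) — and (ii) some conjugate `g γ′ g⁻¹` lies in the compact set `tsupport a′` (★
`orbitalIntegral_eq_zero_of_forall_notMem_tsupport`); hence `ι_∞(γ_H)` is `GL₃(L ⊗ ℝ)`-conjugate into the compact image `K` of `tsupport a′`.  The Lie-group
input (EIG→CPT) — «a `G`-regular `γ_H ∈ H_∞` with `ι_∞(γ_H)` conjugate into a compact `K ⊆ GL₃(L ⊗ ℝ)` is stably conjugate to a point of a compact `C(K) ⊆ H_∞`»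
(eigenvalues in a compact of `ℂˣ` place by place; a regular semisimple element of `U(1,1)` is conjugate over `ℂ` into the compact torus or a compact piece of the
split torus; `U(1)` is compact) — is organ (EIG→CPT) of seat LH3-p03 and enters here as an explicit HYPOTHESIS (its closed text, §1); the head of §2 is the
organ text `TransferSideBoundedStatement` of the skeleton `F0/P3c/LH3/LH3-plan/g0/StubN9.paydown.skeleton.v1.lean` (sha16 f92b318549b63e57, :160–190) with the
kit abbreviations `GpInf ∕ GInf ∕ HInf` spelled out, CONDITIONAL on that hypothesis.
* §1 `exists_isCompact_finsum_delta_mul_classOrbitalIntegral_eq_zero` — for ANY archimedean transfer factor `T` (★ `ArchTransferFactor`), ANY orbital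
  measure family `m′` on `G′_∞` and any `a′` of compact support: a compact `C ⊆ H_∞` off whose stable classes the `Δ`-side vanishes at the `G`-regular points.
* §2 `archTransferSideBounded_of` — the organ text (every compatible Weil-form system, the guard, the μ-guard, Borel σ-algebras on the orbit quotients,
  `Δ″_∞ = archExplicitTransferFactor L H μ hl hr`, `a′ ∈ C_c^∞(G′_∞)` = ★ `ArchSmooth`) from (EIG→CPT); measures and guards are not read.

EDITION LOG.  ED. 1 (★ p847961): §1–§2, the organ modulo (EIG→CPT).  ED. 2 (append-only; one import added): §3 `archTransferSideBounded` — the organ text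
HYPOTHESIS-FREE, by ★ p848061 `exists_isCompact_isArchStablyConjH_of_isConj_endoEmbArch` (LH3-p03's (EIG→CPT): eigenvalues bounded along the norm
correspondence, ★ p848059 ∕ p848061 §1–§2; a `G`-regular element of `U(1,1) × U(1)` with bounded eigenvalues is stably conjugate into a compact torus piece,
★ p847990).  `stub_N9transferSideBounded` of `F0_P3c_StubN9Paydown` closes by `exact Literature.NumberTheory.Rogawski1990.archTransferSideBounded`.

## References
* [Shelstad2012] D. Shelstad, *On geometric transfer in real twisted endoscopy*, Ann. of Math. 176 (2012) 1919–1985: Cor. 2.2 and its proof p. 1926 (held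
  `paper:doi-10-4007-annals-2012-176-3-9`, p0008 l. 11–19), statement of the identity p. 1925 (p0007 l. 1–4).
* [Rogawski1990] J. D. Rogawski, *Automorphic Representations of Unitary Groups in Three Variables*, Ann. of Math. Stud. 123 (1990): §4.3 (4.3.1) p. 43,
  §14.3 pp. 233–234.
* [Bouaziz1994] A. Bouaziz, *Intégrales orbitales sur les groupes de Lie réductifs*, Ann. Sci. ÉNS 27 (1994), Thm. 6.2.1 (the consumer of this support bound).
-/

set_option autoImplicit false

noncomputable section

open MeasureTheory NumberField IsDedekindDomain
open scoped Matrix MatrixGroups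

namespace Literature.NumberTheory.Rogawski1990

open Literature.NumberTheory.Automorphic Literature.NumberTheory.GaloisRepresentations

/-! ## §1 The factor-generic support statement, from (EIG→CPT) -/

section Core

variable (L : Type) [Field L] [NumberField L] [IsCMField L] (H : Matrix (Fin 3) (Fin 3) L)

/-- **THE `Δ`-SIDE OF (4.3.1) VANISHES OFF THE STABLE CLASSES MEETING A COMPACT SET.**  Hypothesis `hEC` = organ (EIG→CPT) as a closed text: every
`G`-regular `γ_H ∈ H_∞` whose image `ι_∞(γ_H)` is `GL₃(L ⊗ ℝ)`-conjugate into a compact `K` has a stable conjugate in a compact `C(K) ⊆ H_∞`.  Conclusion: for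
every archimedean transfer factor `T` (supported on the norm pairs `ι_∞(γ_H) ↔ γ′`), every orbital measure family `m′` on `G′_∞ = U(H)(L⁺ ⊗ ℝ)` (any σ-algebras
on the orbit quotients) and every compactly supported `a′` on `G′_∞` there is a compact `C ⊆ H_∞` with `Σᶠ_{[γ′]} T(γ_H, out[γ′]) · Φ([γ′], a′) = 0` at every
`G`-regular `γ_H` all of whose stable conjugates avoid `C`: a non-zero term needs `ι_∞(γ_H) ↔ out[γ′]` (★ `TransferFactorData.eq_zero_of_not_rel`) and a
conjugate of `out[γ′]` in `tsupport a′` (★ `orbitalIntegral_eq_zero_of_forall_notMem_tsupport`), whence `ι_∞(γ_H)` is conjugate into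
`K := Subtype.val '' tsupport a′`, compact. [cite: Shelstad2012, Cor. 2.2 p. 1926] [cite: Rogawski1990, §4.3 (4.3.1) p. 43; §14.3 p. 234] -/
theorem exists_isCompact_finsum_delta_mul_classOrbitalIntegral_eq_zero
    (hEC : ∀ (K : Set (GL (Fin 3) (mixedEmbedding.mixedSpace L))), IsCompact K →
      ∃ C : Set (↥(UnitaryGroup.arch (↥(maximalRealSubfield L)) L (IsCMField.complexConj L) 2
              (Matrix.of fun i j : Fin 2 => if i.val + j.val + 1 = 2 then (1 : L) else 0)) ×
            ↥(UnitaryGroup.arch (↥(maximalRealSubfield L)) L (IsCMField.complexConj L) 1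
              (Matrix.of fun i j : Fin 1 => if i.val + j.val + 1 = 1 then (1 : L) else 0))),
        IsCompact C ∧
          ∀ γH, IsArchGRegular L γH →
            (∃ k ∈ K, IsConj ((endoEmbArch L γH).val : GL (Fin 3) (mixedEmbedding.mixedSpace L)) k) →
              ∃ δ ∈ C, IsArchStablyConjH L γH δ)
    {_hγ : ∀ γ : ↥(UnitaryGroup.arch (↥(maximalRealSubfield L)) L (IsCMField.complexConj L) 3 H),
      MeasurableSpace (↥(UnitaryGroup.arch (↥(maximalRealSubfield L)) L (IsCMField.complexConj L) 3 H) ⧸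
        Subgroup.centralizer ({γ} : Set (↥(UnitaryGroup.arch (↥(maximalRealSubfield L)) L (IsCMField.complexConj L) 3 H))))}
    (T : ArchTransferFactor L H)
    (m' : OrbitalMeasureFamily (↥(UnitaryGroup.arch (↥(maximalRealSubfield L)) L (IsCMField.complexConj L) 3 H)))
    {a' : ↥(UnitaryGroup.arch (↥(maximalRealSubfield L)) L (IsCMField.complexConj L) 3 H) → ℂ} (ha' : HasCompactSupport a') :
    ∃ C : Set (↥(UnitaryGroup.arch (↥(maximalRealSubfield L)) L (IsCMField.complexConj L) 2
            (Matrix.of fun i j : Fin 2 => if i.val + j.val + 1 = 2 then (1 : L) else 0)) ×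
          ↥(UnitaryGroup.arch (↥(maximalRealSubfield L)) L (IsCMField.complexConj L) 1
            (Matrix.of fun i j : Fin 1 => if i.val + j.val + 1 = 1 then (1 : L) else 0))),
      IsCompact C ∧
        ∀ γH, IsArchGRegular L γH → (∀ δ, IsArchStablyConjH L γH δ → δ ∉ C) →
          ∑ᶠ c : ConjClasses (↥(UnitaryGroup.arch (↥(maximalRealSubfield L)) L (IsCMField.complexConj L) 3 H)),
              T.Δ γH (Quotient.out c) * classOrbitalIntegral m' a' c = 0 := by
  -- the compact `K := tsupport a′` read in `GL₃(L ⊗ ℝ)`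
  obtain ⟨C, hC, hCK⟩ := hEC (Subtype.val '' tsupport a') (ha'.isCompact.image continuous_subtype_val)
  refine ⟨C, hC, fun γH hreg hmiss => ?_⟩
  -- every term of the `finsum` vanishes
  have hterm : ∀ c : ConjClasses (↥(UnitaryGroup.arch (↥(maximalRealSubfield L)) L (IsCMField.complexConj L) 3 H)),
      T.Δ γH (Quotient.out c) * classOrbitalIntegral m' a' c = 0 := by
    intro c
    by_cases hrel : IsArchNormPair L H γH (Quotient.out c)
    · -- `ι_∞(γ_H) ↔ out c`: then no conjugate of `out c` meets `tsupport a′`, so `Φ([out c], a′) = 0`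
      have hΦ : classOrbitalIntegral m' a' c = 0 := by
        rw [classOrbitalIntegral_eq]
        refine orbitalIntegral_eq_zero_of_forall_notMem_tsupport (Quotient.out c) (m' c) fun g hg => ?_
        -- `k := g · out c · g⁻¹ ∈ tsupport a′` would put `ι_∞(γ_H)` into the conjugacy class of a point of `K`
        have hk : ((g * Quotient.out c * g⁻¹ :
            ↥(UnitaryGroup.arch (↥(maximalRealSubfield L)) L (IsCMField.complexConj L) 3 H)).val :
              GL (Fin 3) (mixedEmbedding.mixedSpace L)) ∈ Subtype.val '' tsupport a' :=
          ⟨_, hg, rfl⟩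
        have hconj : IsConj ((Quotient.out c :
            ↥(UnitaryGroup.arch (↥(maximalRealSubfield L)) L (IsCMField.complexConj L) 3 H)).val :
              GL (Fin 3) (mixedEmbedding.mixedSpace L))
            ((g * Quotient.out c * g⁻¹ :
              ↥(UnitaryGroup.arch (↥(maximalRealSubfield L)) L (IsCMField.complexConj L) 3 H)).val) :=
          isConj_iff.mpr ⟨g.val, by simp only [Subgroup.coe_mul, Subgroup.coe_inv]⟩
        have hι : IsConj ((endoEmbArch L γH).val : GL (Fin 3) (mixedEmbedding.mixedSpace L))
            ((g * Quotient.out c * g⁻¹ :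
              ↥(UnitaryGroup.arch (↥(maximalRealSubfield L)) L (IsCMField.complexConj L) 3 H)).val) :=
          IsConj.trans hrel hconj
        obtain ⟨δ, hδC, hδ⟩ := hCK γH hreg ⟨_, hk, hι⟩
        exact hmiss δ hδ hδC
      rw [hΦ, mul_zero]
    · rw [T.eq_zero_of_not_rel _ _ hrel, zero_mul]
  simp only [hterm, finsum_zero]

end Core

/-! ## §2 The organ text of `stub_N9transferSideBounded`, conditional on (EIG→CPT) -/

/-- **O2 `stub_N9transferSideBounded` FROM (EIG→CPT)** — the organ text `TransferSideBoundedStatement` of the `stub_N9` pay-down skeleton v1 (LH3-plan (g0),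
sha16 f92b318549b63e57, :160–190) VERBATIM with the kit abbreviations `GpInf L H ∕ GInf L ∕ HInf L` spelled out: over the frame of `stub_N9` (every compatible
Weil-form system `(m′, m, mH, t′, t, tH)`, the hermitian∕anisotropic guard, the μ-guard, Borel σ-algebras on the orbit quotients), for every
`a′ ∈ C_c^∞(G′_∞)` (★ `ArchSmooth`) there is a compact `C ⊆ H_∞` such that `Σᶠ_{[γ′]} Δ″_∞(γ_H, out[γ′]) · Φ([γ′], a′) = 0` at every `G`-regular `γ_H` no
stable conjugate of which lies in `C` (`Δ″_∞ = archExplicitTransferFactor L H μ hl hr`).  By §1 at `T := Δ″_∞` and `HasCompactSupport a′` (★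
`ArchSmooth.hasCompactSupport`); the measures, the systems and the guards are not read. [cite: Shelstad2012, Cor. 2.2 p. 1926]
[cite: Rogawski1990, §4.3 (4.3.1) p. 43; §14.3 p. 234] -/
theorem archTransferSideBounded_of
    (hEC : ∀ (L : Type) [Field L] [NumberField L] [IsCMField L]
      (K : Set (GL (Fin 3) (mixedEmbedding.mixedSpace L))), IsCompact K →
      ∃ C : Set (↥(UnitaryGroup.arch (↥(maximalRealSubfield L)) L (IsCMField.complexConj L) 2
              (Matrix.of fun i j : Fin 2 => if i.val + j.val + 1 = 2 then (1 : L) else 0)) ×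
            ↥(UnitaryGroup.arch (↥(maximalRealSubfield L)) L (IsCMField.complexConj L) 1
              (Matrix.of fun i j : Fin 1 => if i.val + j.val + 1 = 1 then (1 : L) else 0))),
        IsCompact C ∧
          ∀ γH, IsArchGRegular L γH →
            (∃ k ∈ K, IsConj ((endoEmbArch L γH).val : GL (Fin 3) (mixedEmbedding.mixedSpace L)) k) →
              ∃ δ ∈ C, IsArchStablyConjH L γH δ) :
    ∀ (L : Type) [Field L] [NumberField L] [IsCMField L] (H : Matrix (Fin 3) (Fin 3) L)
      [MeasurableSpace (↥(UnitaryGroup.arch (↥(maximalRealSubfield L)) L (IsCMField.complexConj L) 3 H))] [BorelSpace (↥(UnitaryGroup.arch (↥(maximalRealSubfield L)) L (IsCMField.complexConj L) 3 H))] [MeasurableSpace (↥(UnitaryGroup.arch (↥(maximalRealSubfield L)) L (IsCMField.complexConj L) 3 (Matrix.of fun i j : Fin 3 => if i.val + j.val + 1 = 3 then (1 : L) else 0)))] [BorelSpace (↥(UnitaryGroup.arch (↥(maximalRealSubfield L)) L (IsCMField.complexConj L) 3 (Matrix.of fun i j : Fin 3 => if i.val + j.val + 1 = 3 then (1 : L)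 else 0)))]
      [MeasurableSpace ((↥(UnitaryGroup.arch (↥(maximalRealSubfield L)) L (IsCMField.complexConj L) 2 (Matrix.of fun i j : Fin 2 => if i.val + j.val + 1 = 2 then (1 : L) else 0)) × ↥(UnitaryGroup.arch (↥(maximalRealSubfield L)) L (IsCMField.complexConj L) 1 (Matrix.of fun i j : Fin 1 => if i.val + j.val + 1 = 1 then (1 : L) else 0))))] [BorelSpace ((↥(UnitaryGroup.arch (↥(maximalRealSubfield L)) L (IsCMField.complexConj L) 2 (Matrix.of fun i j : Fin 2 => if i.val + j.val + 1 = 2 then (1 : L) else 0)) × ↥(UnitaryGroup.arch (↥(maximalRealSubfield L)) L (IsCMField.complexConj L) 1 (Matrix.of fun i j : Fin 1 => if i.val + j.val + 1 = 1 then (1 : L) else 0))))]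
      (ν' : Measure (↥(UnitaryGroup.arch (↥(maximalRealSubfield L)) L (IsCMField.complexConj L) 3 H))) (ν : Measure (↥(UnitaryGroup.arch (↥(maximalRealSubfield L)) L (IsCMField.complexConj L) 3 (Matrix.of fun i j : Fin 3 => if i.val + j.val + 1 = 3 then (1 : L) else 0)))) (νH : Measure ((↥(UnitaryGroup.arch (↥(maximalRealSubfield L)) L (IsCMField.complexConj L) 2 (Matrix.of fun i j : Fin 2 => if i.val + j.val + 1 = 2 then (1 : L) else 0)) × ↥(UnitaryGroup.arch (↥(maximalRealSubfield L)) L (IsCMField.complexConj L) 1 (Matrix.of fun i j : Fin 1 => if i.val + j.val + 1 = 1 then (1 : L) else 0)))))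
      [ν'.IsHaarMeasure] [ν'.IsMulRightInvariant] [ν.IsHaarMeasure] [ν.IsMulRightInvariant] [νH.IsHaarMeasure] [νH.IsMulRightInvariant]
      (μ : HeckeCharacter L) (_hμu : μ.IsUnitary)
      (_hμω : ∀ x : Literature.NumberTheory.GaloisRepresentations.ideleGroup ↥(maximalRealSubfield L), μ (AdeleRing.ideleBaseChange (↥(maximalRealSubfield L)) L x) = quadraticHeckeCharCM L x)
      (hl : ∀ (a : (↥(UnitaryGroup.arch (↥(maximalRealSubfield L)) L (IsCMField.complexConj L) 2 (Matrix.of fun i j : Fin 2 => if i.val + j.val + 1 = 2 then (1 : L) else 0)) × ↥(UnitaryGroup.arch (↥(maximalRealSubfield L)) L (IsCMField.complexConj L) 1 (Matrix.of fun i j : Fin 1 => if i.val + j.val + 1 = 1 then (1 : L) else 0)))) (b : ↥(UnitaryGroup.arch (↥(maximalRealSubfield L)) L (IsCMField.complexConj L) 3 H)) (x : (↥(UnitaryGroup.arch (↥(maximalRealSubfield L)) L (IsCMField.complexConj L) 2 (Matrix.of fun i j : Fin 2 => if i.val + j.val + 1 = 2 then (1 : L) else 0)) × ↥(UnitaryGroup.arch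 (↥(maximalRealSubfield L)) L (IsCMField.complexConj L) 1 (Matrix.of fun i j : Fin 1 => if i.val + j.val + 1 = 1 then (1 : L) else 0)))), archExplicitDelta L H (x * a * x⁻¹) μ b = archExplicitDelta L H a μ b)
      (hr : ∀ (a : (↥(UnitaryGroup.arch (↥(maximalRealSubfield L)) L (IsCMField.complexConj L) 2 (Matrix.of fun i j : Fin 2 => if i.val + j.val + 1 = 2 then (1 : L) else 0)) × ↥(UnitaryGroup.arch (↥(maximalRealSubfield L)) L (IsCMField.complexConj L) 1 (Matrix.of fun i j : Fin 1 => if i.val + j.val + 1 = 1 then (1 : L) else 0)))) (b y : ↥(UnitaryGroup.arch (↥(maximalRealSubfield L)) L (IsCMField.complexConj L) 3 H)), archExplicitDelta L H a μ (y * b * y⁻¹) = archExplicitDelta L H a μ b),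
      (H.map (cmConjRingHom L)).transpose = H →
        ∀ hanis : (∀ x : Fin 3 → L, Literature.AlgebraicGeometry.ShimuraVarieties.hermForm (cmConjRingHom L) H x x = 0 → x = 0),
          letI : ∀ γ : ↥(UnitaryGroup.arch (↥(maximalRealSubfield L)) L (IsCMField.complexConj L) 3 H), MeasurableSpace (↥(UnitaryGroup.arch (↥(maximalRealSubfield L)) L (IsCMField.complexConj L) 3 H) ⧸ Subgroup.centralizer ({γ} : Set (↥(UnitaryGroup.arch (↥(maximalRealSubfield L)) L (IsCMField.complexConj L) 3 H)))) := fun _ => borel _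
          haveI : ∀ γ : ↥(UnitaryGroup.arch (↥(maximalRealSubfield L)) L (IsCMField.complexConj L) 3 H), BorelSpace (↥(UnitaryGroup.arch (↥(maximalRealSubfield L)) L (IsCMField.complexConj L) 3 H) ⧸ Subgroup.centralizer ({γ} : Set (↥(UnitaryGroup.arch (↥(maximalRealSubfield L)) L (IsCMField.complexConj L) 3 H)))) := fun _ => ⟨rfl⟩
          letI : ∀ γ : ↥(UnitaryGroup.arch (↥(maximalRealSubfield L)) L (IsCMField.complexConj L) 3 (Matrix.of fun i j : Fin 3 => if i.val + j.val + 1 = 3 then (1 : L) else 0)), MeasurableSpace (↥(UnitaryGroup.arch (↥(maximalRealSubfield L)) L (IsCMField.complexConj L) 3 (Matrix.of fun i j : Fin 3 => if i.val + j.val + 1 = 3 then (1 : L) else 0)) ⧸ Subgroup.centralizer ({γ} : Set (↥(UnitaryGroup.arch (↥(maximalRealSubfield L)) L (IsCMField.complexConj L) 3 (Matrix.of fun i j : Fin 3 => if i.val + j.val + 1 = 3 then (1 : L) else 0))))) := fun _ => borel _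
          haveI : ∀ γ : ↥(UnitaryGroup.arch (↥(maximalRealSubfield L)) L (IsCMField.complexConj L) 3 (Matrix.of fun i j : Fin 3 => if i.val + j.val + 1 = 3 then (1 : L) else 0)), BorelSpace (↥(UnitaryGroup.arch (↥(maximalRealSubfield L)) L (IsCMField.complexConj L) 3 (Matrix.of fun i j : Fin 3 => if i.val + j.val + 1 = 3 then (1 : L) else 0)) ⧸ Subgroup.centralizer ({γ} : Set (↥(UnitaryGroup.arch (↥(maximalRealSubfield L)) L (IsCMField.complexConj L) 3 (Matrix.of fun i j : Fin 3 => if i.val + j.val + 1 = 3 then (1 : L) else 0))))) := fun _ => ⟨rfl⟩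
          letI : ∀ a : (↥(UnitaryGroup.arch (↥(maximalRealSubfield L)) L (IsCMField.complexConj L) 2 (Matrix.of fun i j : Fin 2 => if i.val + j.val + 1 = 2 then (1 : L) else 0)) × ↥(UnitaryGroup.arch (↥(maximalRealSubfield L)) L (IsCMField.complexConj L) 1 (Matrix.of fun i j : Fin 1 => if i.val + j.val + 1 = 1 then (1 : L) else 0))), MeasurableSpace ((↥(UnitaryGroup.arch (↥(maximalRealSubfield L)) L (IsCMField.complexConj L) 2 (Matrix.of fun i j : Fin 2 => if i.val + j.val + 1 = 2 then (1 : L) else 0)) × ↥(UnitaryGroup.arch (↥(maximalRealSubfield L)) L (IsCMField.complexConj L) 1 (Matrix.of fun i j : Fin 1 => if i.val + j.val + 1 = 1 then (1 : L) else 0))) ⧸ Subgroup.centralizer ({a} : Set ((↥(UnitaryGroup.arch (↥(maximalRealSubfield L)) L (IsCMField.complexConj L) 2 (Matrix.of fun i j : Fin 2 => if i.val + j.val + 1 = 2 then (1 : L) else 0)) × ↥(UnitaryGroup.arch (↥(maximalRealSubfield L)) L (IsCMField.complexConj L) 1 (Matrix.of fun i j : Fin 1 => if i.val + j.val + 1 =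 1 then (1 : L) else 0)))))) := fun _ => borel _
          haveI : ∀ a : (↥(UnitaryGroup.arch (↥(maximalRealSubfield L)) L (IsCMField.complexConj L) 2 (Matrix.of fun i j : Fin 2 => if i.val + j.val + 1 = 2 then (1 : L) else 0)) × ↥(UnitaryGroup.arch (↥(maximalRealSubfield L)) L (IsCMField.complexConj L) 1 (Matrix.of fun i j : Fin 1 => if i.val + j.val + 1 = 1 then (1 : L) else 0))), BorelSpace ((↥(UnitaryGroup.arch (↥(maximalRealSubfield L)) L (IsCMField.complexConj L) 2 (Matrix.of fun i j : Fin 2 => if i.val + j.val + 1 = 2 then (1 : L) else 0)) × ↥(UnitaryGroup.arch (↥(maximalRealSubfield L)) L (IsCMField.complexConj L) 1 (Matrix.of fun i j : Fin 1 => if i.val + j.val + 1 = 1 then (1 : L) else 0))) ⧸ Subgroup.centralizer ({a} : Set ((↥(UnitaryGroup.arch (↥(maximalRealSubfield L)) L (IsCMField.complexConj L) 2 (Matrix.of fun i j : Fin 2 => if i.val + j.val + 1 = 2 then (1 : L) else 0)) × ↥(UnitaryGroup.arch (↥(maximalRealSubfield L)) L (IsCMField.complexConj L) 1 (Matrix.of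 fun i j : Fin 1 => if i.val + j.val + 1 = 1 then (1 : L) else 0)))))) := fun _ => ⟨rfl⟩
          ∀ (m' : OrbitalMeasureFamily (↥(UnitaryGroup.arch (↥(maximalRealSubfield L)) L (IsCMField.complexConj L) 3 H))) (m : OrbitalMeasureFamily (↥(UnitaryGroup.arch (↥(maximalRealSubfield L)) L (IsCMField.complexConj L) 3 (Matrix.of fun i j : Fin 3 => if i.val + j.val + 1 = 3 then (1 : L) else 0)))) (mH : OrbitalMeasureFamily ((↥(UnitaryGroup.arch (↥(maximalRealSubfield L)) L (IsCMField.complexConj L) 2 (Matrix.of fun i j : Fin 2 => if i.val + j.val + 1 = 2 then (1 : L) else 0)) × ↥(UnitaryGroup.arch (↥(maximalRealSubfield L)) L (IsCMField.complexConj L) 1 (Matrix.of fun i j : Fin 1 => if i.val + j.val + 1 = 1 then (1 : L) else 0)))))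
            (t' : ∀ γ' : ↥(UnitaryGroup.arch (↥(maximalRealSubfield L)) L (IsCMField.complexConj L) 3 H), Measure (Subgroup.centralizer ({γ'} : Set (↥(UnitaryGroup.arch (↥(maximalRealSubfield L)) L (IsCMField.complexConj L) 3 H)))))
            (t : ∀ γ : ↥(UnitaryGroup.arch (↥(maximalRealSubfield L)) L (IsCMField.complexConj L) 3 (Matrix.of fun i j : Fin 3 => if i.val + j.val + 1 = 3 then (1 : L) else 0)), Measure (Subgroup.centralizer ({γ} : Set (↥(UnitaryGroup.arch (↥(maximalRealSubfield L)) L (IsCMField.complexConj L) 3 (Matrix.of fun i j : Fin 3 => if i.val + j.val + 1 = 3 then (1 : L) else 0))))))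
            (tH : ∀ γH : (↥(UnitaryGroup.arch (↥(maximalRealSubfield L)) L (IsCMField.complexConj L) 2 (Matrix.of fun i j : Fin 2 => if i.val + j.val + 1 = 2 then (1 : L) else 0)) × ↥(UnitaryGroup.arch (↥(maximalRealSubfield L)) L (IsCMField.complexConj L) 1 (Matrix.of fun i j : Fin 1 => if i.val + j.val + 1 = 1 then (1 : L) else 0))), Measure (Subgroup.centralizer ({γH} : Set ((↥(UnitaryGroup.arch (↥(maximalRealSubfield L)) L (IsCMField.complexConj L) 2 (Matrix.of fun i j : Fin 2 => if i.val + j.val + 1 = 2 then (1 : L) else 0)) × ↥(UnitaryGroup.arch (↥(maximalRealSubfield L)) L (IsCMField.complexConj L) 1 (Matrix.of fun i j : Fin 1 => if i.val + j.val + 1 = 1 then (1 : L) else 0))))))),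
            ArchCompatibleFamiliesG L H ν' ν hanis m' m t' t → ArchCompatibleFamiliesH L νH mH tH t →
              ∀ a' : ↥(UnitaryGroup.arch (↥(maximalRealSubfield L)) L (IsCMField.complexConj L) 3 H) → ℂ, ArchSmooth L 3 H a' →
                ∃ C : Set ((↥(UnitaryGroup.arch (↥(maximalRealSubfield L)) L (IsCMField.complexConj L) 2 (Matrix.of fun i j : Fin 2 => if i.val + j.val + 1 = 2 then (1 : L) else 0)) × ↥(UnitaryGroup.arch (↥(maximalRealSubfield L)) L (IsCMField.complexConj L) 1 (Matrix.of fun i j : Fin 1 => if i.val + j.val + 1 = 1 then (1 : L) else 0)))), IsCompact C ∧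
                  ∀ γH : (↥(UnitaryGroup.arch (↥(maximalRealSubfield L)) L (IsCMField.complexConj L) 2 (Matrix.of fun i j : Fin 2 => if i.val + j.val + 1 = 2 then (1 : L) else 0)) × ↥(UnitaryGroup.arch (↥(maximalRealSubfield L)) L (IsCMField.complexConj L) 1 (Matrix.of fun i j : Fin 1 => if i.val + j.val + 1 = 1 then (1 : L) else 0))), IsArchGRegular L γH → (∀ δ : (↥(UnitaryGroup.arch (↥(maximalRealSubfield L)) L (IsCMField.complexConj L) 2 (Matrix.of fun i j : Fin 2 => if i.val + j.val + 1 = 2 then (1 : L) else 0)) × ↥(UnitaryGroup.arch (↥(maximalRealSubfield L)) L (IsCMField.complexConj L) 1 (Matrix.of fun i j : Fin 1 => if i.val + j.val + 1 = 1 then (1 : L) else 0))), IsArchStablyConjH L γH δ → δ ∉ C) →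
                    ∑ᶠ c : ConjClasses (↥(UnitaryGroup.arch (↥(maximalRealSubfield L)) L (IsCMField.complexConj L) 3 H)),
                        (archExplicitTransferFactor L H μ hl hr).Δ γH (Quotient.out c) * classOrbitalIntegral m' a' c = 0 := by
  intro L _ _ _ H _ _ _ _ _ _ _ν' _ν _νH _ _ _ _ _ _ μ _hμu _hμω hl hr _hherm _hanis m' _m _mH _t' _t _tH _hG _hH a' ha'
  exact exists_isCompact_finsum_delta_mul_classOrbitalIntegral_eq_zero L H (hEC L)
    (archExplicitTransferFactor L H μ hl hr) m' (ArchSmooth.hasCompactSupport L 3 H ha')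

/-! ## §3 (ED. 2) The organ text, hypothesis-free -/

/-- **O2 `stub_N9transferSideBounded` — PAID.**  The organ text `TransferSideBoundedStatement` of the `stub_N9` pay-down skeleton v1 (LH3-plan (g0); statement
bytes unchanged through ED. 3 9eb06927759a436b, :160–190) VERBATIM with the kit abbreviations spelled out: for every `a′ ∈ C_c^∞(G′_∞)` there is a compact
`C ⊆ H_∞` such that the `Δ″_∞`-side `Σᶠ_{[γ′]} Δ″_∞(γ_H, out[γ′]) · Φ([γ′], a′)` vanishes at every `G`-regular `γ_H` no stable conjugate of which lies in `C`
(§2 at LH3-p03's ★ `exists_isCompact_isArchStablyConjH_of_isConj_endoEmbArch`).  This is the «bounded modulo `Z₁(ℝ)`» clause of the proof of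
[Shelstad2012, Cor. 2.2] for `(G′_∞, H_∞)` (`Z(H_∞)` compact). [cite: Shelstad2012, Cor. 2.2 p. 1926] [cite: Rogawski1990, §4.3 (4.3.1) p. 43; §14.3 p. 234] -/
theorem archTransferSideBounded :
    ∀ (L : Type) [Field L] [NumberField L] [IsCMField L] (H : Matrix (Fin 3) (Fin 3) L)
      [MeasurableSpace (↥(UnitaryGroup.arch (↥(maximalRealSubfield L)) L (IsCMField.complexConj L) 3 H))] [BorelSpace (↥(UnitaryGroup.arch (↥(maximalRealSubfield L)) L (IsCMField.complexConj L) 3 H))] [MeasurableSpace (↥(UnitaryGroup.arch (↥(maximalRealSubfield L)) L (IsCMField.complexConj L) 3 (Matrix.of fun i j : Fin 3 => if i.val + j.val + 1 = 3 then (1 : L) else 0)))] [BorelSpace (↥(UnitaryGroup.arch (↥(maximalRealSubfield L)) L (IsCMField.complexConj L) 3 (Matrix.of fun i j : Fin 3 => if i.val + j.val + 1 = 3 then (1 : L) else 0)))]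
      [MeasurableSpace ((↥(UnitaryGroup.arch (↥(maximalRealSubfield L)) L (IsCMField.complexConj L) 2 (Matrix.of fun i j : Fin 2 => if i.val + j.val + 1 = 2 then (1 : L) else 0)) × ↥(UnitaryGroup.arch (↥(maximalRealSubfield L)) L (IsCMField.complexConj L) 1 (Matrix.of fun i j : Fin 1 => if i.val + j.val + 1 = 1 then (1 : L) else 0))))] [BorelSpace ((↥(UnitaryGroup.arch (↥(maximalRealSubfield L)) L (IsCMField.complexConj L) 2 (Matrix.of fun i j : Fin 2 => if i.val + j.val + 1 = 2 then (1 : L) else 0)) × ↥(UnitaryGroup.arch (↥(maximalRealSubfield L)) L (IsCMField.complexConj L) 1 (Matrix.of fun i j : Fin 1 => if i.val + j.val + 1 = 1 then (1 : L) else 0))))]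
      (ν' : Measure (↥(UnitaryGroup.arch (↥(maximalRealSubfield L)) L (IsCMField.complexConj L) 3 H))) (ν : Measure (↥(UnitaryGroup.arch (↥(maximalRealSubfield L)) L (IsCMField.complexConj L) 3 (Matrix.of fun i j : Fin 3 => if i.val + j.val + 1 = 3 then (1 : L) else 0)))) (νH : Measure ((↥(UnitaryGroup.arch (↥(maximalRealSubfield L)) L (IsCMField.complexConj L) 2 (Matrix.of fun i j : Fin 2 => if i.val + j.val + 1 = 2 then (1 : L) else 0)) × ↥(UnitaryGroup.arch (↥(maximalRealSubfield L)) L (IsCMField.complexConj L) 1 (Matrix.of fun i j : Fin 1 => if i.val + j.val + 1 = 1 then (1 : L) else 0)))))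
      [ν'.IsHaarMeasure] [ν'.IsMulRightInvariant] [ν.IsHaarMeasure] [ν.IsMulRightInvariant] [νH.IsHaarMeasure] [νH.IsMulRightInvariant]
      (μ : HeckeCharacter L) (_hμu : μ.IsUnitary)
      (_hμω : ∀ x : Literature.NumberTheory.GaloisRepresentations.ideleGroup ↥(maximalRealSubfield L), μ (AdeleRing.ideleBaseChange (↥(maximalRealSubfield L)) L x) = quadraticHeckeCharCM L x)
      (hl : ∀ (a : (↥(UnitaryGroup.arch (↥(maximalRealSubfield L)) L (IsCMField.complexConj L) 2 (Matrix.of fun i j : Fin 2 => if i.val + j.val + 1 = 2 then (1 : L) else 0)) × ↥(UnitaryGroup.arch (↥(maximalRealSubfield L)) L (IsCMField.complexConj L) 1 (Matrix.of fun i j : Fin 1 => if i.val + j.val + 1 = 1 then (1 : L) else 0)))) (b : ↥(UnitaryGroup.arch (↥(maximalRealSubfield L)) L (IsCMField.complexConj L) 3 H)) (x : (↥(UnitaryGroup.arch (↥(maximalRealSubfield L)) L (IsCMField.complexConj L) 2 (Matrix.of fun i j : Fin 2 => if i.val + j.val + 1 = 2 then (1 : L) else 0)) × ↥(UnitaryGroup.arch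 (↥(maximalRealSubfield L)) L (IsCMField.complexConj L) 1 (Matrix.of fun i j : Fin 1 => if i.val + j.val + 1 = 1 then (1 : L) else 0)))), archExplicitDelta L H (x * a * x⁻¹) μ b = archExplicitDelta L H a μ b)
      (hr : ∀ (a : (↥(UnitaryGroup.arch (↥(maximalRealSubfield L)) L (IsCMField.complexConj L) 2 (Matrix.of fun i j : Fin 2 => if i.val + j.val + 1 = 2 then (1 : L) else 0)) × ↥(UnitaryGroup.arch (↥(maximalRealSubfield L)) L (IsCMField.complexConj L) 1 (Matrix.of fun i j : Fin 1 => if i.val + j.val + 1 = 1 then (1 : L) else 0)))) (b y : ↥(UnitaryGroup.arch (↥(maximalRealSubfield L)) L (IsCMField.complexConj L) 3 H)), archExplicitDelta L H a μ (y * b * y⁻¹) = archExplicitDelta L H a μ b),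
      (H.map (cmConjRingHom L)).transpose = H →
        ∀ hanis : (∀ x : Fin 3 → L, Literature.AlgebraicGeometry.ShimuraVarieties.hermForm (cmConjRingHom L) H x x = 0 → x = 0),
          letI : ∀ γ : ↥(UnitaryGroup.arch (↥(maximalRealSubfield L)) L (IsCMField.complexConj L) 3 H), MeasurableSpace (↥(UnitaryGroup.arch (↥(maximalRealSubfield L)) L (IsCMField.complexConj L) 3 H) ⧸ Subgroup.centralizer ({γ} : Set (↥(UnitaryGroup.arch (↥(maximalRealSubfield L)) L (IsCMField.complexConj L) 3 H)))) := fun _ => borel _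
          haveI : ∀ γ : ↥(UnitaryGroup.arch (↥(maximalRealSubfield L)) L (IsCMField.complexConj L) 3 H), BorelSpace (↥(UnitaryGroup.arch (↥(maximalRealSubfield L)) L (IsCMField.complexConj L) 3 H) ⧸ Subgroup.centralizer ({γ} : Set (↥(UnitaryGroup.arch (↥(maximalRealSubfield L)) L (IsCMField.complexConj L) 3 H)))) := fun _ => ⟨rfl⟩
          letI : ∀ γ : ↥(UnitaryGroup.arch (↥(maximalRealSubfield L)) L (IsCMField.complexConj L) 3 (Matrix.of fun i j : Fin 3 => if i.val + j.val + 1 = 3 then (1 : L) else 0)), MeasurableSpace (↥(UnitaryGroup.arch (↥(maximalRealSubfield L)) L (IsCMField.complexConj L) 3 (Matrix.of fun i j : Fin 3 => if i.val + j.val + 1 = 3 then (1 : L) else 0)) ⧸ Subgroup.centralizer ({γ} : Set (↥(UnitaryGroup.arch (↥(maximalRealSubfield L)) L (IsCMField.complexConj L) 3 (Matrix.of fun i j : Fin 3 => if i.val + j.val + 1 = 3 then (1 : L) else 0))))) := fun _ => borel _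
          haveI : ∀ γ : ↥(UnitaryGroup.arch (↥(maximalRealSubfield L)) L (IsCMField.complexConj L) 3 (Matrix.of fun i j : Fin 3 => if i.val + j.val + 1 = 3 then (1 : L) else 0)), BorelSpace (↥(UnitaryGroup.arch (↥(maximalRealSubfield L)) L (IsCMField.complexConj L) 3 (Matrix.of fun i j : Fin 3 => if i.val + j.val + 1 = 3 then (1 : L) else 0)) ⧸ Subgroup.centralizer ({γ} : Set (↥(UnitaryGroup.arch (↥(maximalRealSubfield L)) L (IsCMField.complexConj L) 3 (Matrix.of fun i j : Fin 3 => if i.val + j.val + 1 = 3 then (1 : L) else 0))))) := fun _ => ⟨rfl⟩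
          letI : ∀ a : (↥(UnitaryGroup.arch (↥(maximalRealSubfield L)) L (IsCMField.complexConj L) 2 (Matrix.of fun i j : Fin 2 => if i.val + j.val + 1 = 2 then (1 : L) else 0)) × ↥(UnitaryGroup.arch (↥(maximalRealSubfield L)) L (IsCMField.complexConj L) 1 (Matrix.of fun i j : Fin 1 => if i.val + j.val + 1 = 1 then (1 : L) else 0))), MeasurableSpace ((↥(UnitaryGroup.arch (↥(maximalRealSubfield L)) L (IsCMField.complexConj L) 2 (Matrix.of fun i j : Fin 2 => if i.val + j.val + 1 = 2 then (1 : L) else 0)) × ↥(UnitaryGroup.arch (↥(maximalRealSubfield L)) L (IsCMField.complexConj L) 1 (Matrix.of fun i j : Fin 1 => if i.val + j.val + 1 = 1 then (1 : L) else 0))) ⧸ Subgroup.centralizer ({a} : Set ((↥(UnitaryGroup.arch (↥(maximalRealSubfield L)) L (IsCMField.complexConj L) 2 (Matrix.of fun i j : Fin 2 => if i.val + j.val + 1 = 2 then (1 : L) else 0)) × ↥(UnitaryGroup.arch (↥(maximalRealSubfield L)) L (IsCMField.complexConj L) 1 (Matrix.of fun i j : Fin 1 => if i.val + j.val + 1 =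 1 then (1 : L) else 0)))))) := fun _ => borel _
          haveI : ∀ a : (↥(UnitaryGroup.arch (↥(maximalRealSubfield L)) L (IsCMField.complexConj L) 2 (Matrix.of fun i j : Fin 2 => if i.val + j.val + 1 = 2 then (1 : L) else 0)) × ↥(UnitaryGroup.arch (↥(maximalRealSubfield L)) L (IsCMField.complexConj L) 1 (Matrix.of fun i j : Fin 1 => if i.val + j.val + 1 = 1 then (1 : L) else 0))), BorelSpace ((↥(UnitaryGroup.arch (↥(maximalRealSubfield L)) L (IsCMField.complexConj L) 2 (Matrix.of fun i j : Fin 2 => if i.val + j.val + 1 = 2 then (1 : L) else 0)) × ↥(UnitaryGroup.arch (↥(maximalRealSubfield L)) L (IsCMField.complexConj L) 1 (Matrix.of fun i j : Fin 1 => if i.val + j.val + 1 = 1 then (1 : L) else 0))) ⧸ Subgroup.centralizer ({a} : Set ((↥(UnitaryGroup.arch (↥(maximalRealSubfield L)) L (IsCMField.complexConj L) 2 (Matrix.of fun i j : Fin 2 => if i.val + j.val + 1 = 2 then (1 : L) else 0)) × ↥(UnitaryGroup.arch (↥(maximalRealSubfield L)) L (IsCMField.complexConj L) 1 (Matrix.of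 fun i j : Fin 1 => if i.val + j.val + 1 = 1 then (1 : L) else 0)))))) := fun _ => ⟨rfl⟩
          ∀ (m' : OrbitalMeasureFamily (↥(UnitaryGroup.arch (↥(maximalRealSubfield L)) L (IsCMField.complexConj L) 3 H))) (m : OrbitalMeasureFamily (↥(UnitaryGroup.arch (↥(maximalRealSubfield L)) L (IsCMField.complexConj L) 3 (Matrix.of fun i j : Fin 3 => if i.val + j.val + 1 = 3 then (1 : L) else 0)))) (mH : OrbitalMeasureFamily ((↥(UnitaryGroup.arch (↥(maximalRealSubfield L)) L (IsCMField.complexConj L) 2 (Matrix.of fun i j : Fin 2 => if i.val + j.val + 1 = 2 then (1 : L) else 0)) × ↥(UnitaryGroup.arch (↥(maximalRealSubfield L)) L (IsCMField.complexConj L) 1 (Matrix.of fun i j : Fin 1 => if i.val + j.val + 1 = 1 then (1 : L) else 0)))))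
            (t' : ∀ γ' : ↥(UnitaryGroup.arch (↥(maximalRealSubfield L)) L (IsCMField.complexConj L) 3 H), Measure (Subgroup.centralizer ({γ'} : Set (↥(UnitaryGroup.arch (↥(maximalRealSubfield L)) L (IsCMField.complexConj L) 3 H)))))
            (t : ∀ γ : ↥(UnitaryGroup.arch (↥(maximalRealSubfield L)) L (IsCMField.complexConj L) 3 (Matrix.of fun i j : Fin 3 => if i.val + j.val + 1 = 3 then (1 : L) else 0)), Measure (Subgroup.centralizer ({γ} : Set (↥(UnitaryGroup.arch (↥(maximalRealSubfield L)) L (IsCMField.complexConj L) 3 (Matrix.of fun i j : Fin 3 => if i.val + j.val + 1 = 3 then (1 : L) else 0))))))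
            (tH : ∀ γH : (↥(UnitaryGroup.arch (↥(maximalRealSubfield L)) L (IsCMField.complexConj L) 2 (Matrix.of fun i j : Fin 2 => if i.val + j.val + 1 = 2 then (1 : L) else 0)) × ↥(UnitaryGroup.arch (↥(maximalRealSubfield L)) L (IsCMField.complexConj L) 1 (Matrix.of fun i j : Fin 1 => if i.val + j.val + 1 = 1 then (1 : L) else 0))), Measure (Subgroup.centralizer ({γH} : Set ((↥(UnitaryGroup.arch (↥(maximalRealSubfield L)) L (IsCMField.complexConj L) 2 (Matrix.of fun i j : Fin 2 => if i.val + j.val + 1 = 2 then (1 : L) else 0)) × ↥(UnitaryGroup.arch (↥(maximalRealSubfield L)) L (IsCMField.complexConj L) 1 (Matrix.of fun i j : Fin 1 => if i.val + j.val + 1 = 1 then (1 : L) else 0))))))),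
            ArchCompatibleFamiliesG L H ν' ν hanis m' m t' t → ArchCompatibleFamiliesH L νH mH tH t →
              ∀ a' : ↥(UnitaryGroup.arch (↥(maximalRealSubfield L)) L (IsCMField.complexConj L) 3 H) → ℂ, ArchSmooth L 3 H a' →
                ∃ C : Set ((↥(UnitaryGroup.arch (↥(maximalRealSubfield L)) L (IsCMField.complexConj L) 2 (Matrix.of fun i j : Fin 2 => if i.val + j.val + 1 = 2 then (1 : L) else 0)) × ↥(UnitaryGroup.arch (↥(maximalRealSubfield L)) L (IsCMField.complexConj L) 1 (Matrix.of fun i j : Fin 1 => if i.val + j.val + 1 = 1 then (1 : L) else 0)))), IsCompact C ∧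
                  ∀ γH : (↥(UnitaryGroup.arch (↥(maximalRealSubfield L)) L (IsCMField.complexConj L) 2 (Matrix.of fun i j : Fin 2 => if i.val + j.val + 1 = 2 then (1 : L) else 0)) × ↥(UnitaryGroup.arch (↥(maximalRealSubfield L)) L (IsCMField.complexConj L) 1 (Matrix.of fun i j : Fin 1 => if i.val + j.val + 1 = 1 then (1 : L) else 0))), IsArchGRegular L γH → (∀ δ : (↥(UnitaryGroup.arch (↥(maximalRealSubfield L)) L (IsCMField.complexConj L) 2 (Matrix.of fun i j : Fin 2 => if i.val + j.val + 1 = 2 then (1 : L) else 0)) × ↥(UnitaryGroup.arch (↥(maximalRealSubfield L)) L (IsCMField.complexConj L) 1 (Matrix.of fun i j : Fin 1 => if i.val + j.val + 1 = 1 then (1 : L) else 0))), IsArchStablyConjH L γH δ → δ ∉ C) →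
                    ∑ᶠ c : ConjClasses (↥(UnitaryGroup.arch (↥(maximalRealSubfield L)) L (IsCMField.complexConj L) 3 H)),
                        (archExplicitTransferFactor L H μ hl hr).Δ γH (Quotient.out c) * classOrbitalIntegral m' a' c = 0 :=
  archTransferSideBounded_of exists_isCompact_isArchStablyConjH_of_isConj_endoEmbArch

end Literature.NumberTheory.Rogawski1990

end
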